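import Literature.NumberTheory.LFunctions.ConreyIwaniec2002CircleMethodDefs
import Literature.NumberTheory.Sieve.RamanujanSum
import Mathlib.Data.Nat.Totient
import HarnessLib

/-!
# Conrey–Iwaniec (2002), proof of Theorem 4.1: Kloosterman's dissection (4.10)–(4.13)

B. Conrey, H. Iwaniec, *Spacing of zeros of Hecke `L`-functions and the class number problem*,
Acta Arith. 103 (2002) 259–312, §4 [held text `paper:arxiv-math_0111012`, p0010:L60–p0011:L5].
From the zero detector (4.10) (the registered input `ZeroDetectorIdentity` of SKELETON S3 v3,
cell `landau-siegel/ls-inputs`, line `theta-circle-method`; proved separately as stub S3b1) this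
file derives, by finite linearity, the form in which the proof of Theorem 4.1 uses it:

* `dissection_fourierChar`: (4.10) for the complex exponentials `e(kθ) + e(−kθ) = 2cos(2πkθ)`;
* `dissection_trigSum`: for any finite trigonometric sum `F(θ) = Σ_i f_i e(k_iθ)` (`k_i ∈ ℤ`),
  `Σ_{c ≤ C < d ≤ c+C, (c,d)=1} ∫₀^{1/cd} (F(a/c − α) + F(−(a/c − α))) dα = Σ_{k_i = 0} f_i` —
  applied to `F(θ) = e(−hθ)S₁(θ)S̄₂(θ)` this is "Hence we get
  `B(h) = Σ_{c ≤ C < d ≤ c+C,(c,d)=1} ∫_{-1/cd}^{1/cd} |S(a'/c − α)|² e(h(α − a'/c))dα` where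
  `a' d ≡ sign α (mod c)`" (the point `−a/c + α`, `α > 0`, is print's `a'/c − α'` with `α' = −α < 0`,
  `a' = −a`);
* `sum_filter_shift_eq`: the bookkeeping `Σ_{(m,n), m−n−h = 0} a(m,n) = Σ_n a(n+h,n)`;
* `sum_intervalIntegral_eq_integral_sum_filter`: the rearrangement (4.11)–(4.13),
  `Σ_{C < d ≤ c+C} ∫₀^{1/cd} G_d(α)dα = ∫₀^{1/(c(C+1))} Σ_{d ∈ I(α)} G_d(α) dα`,
  `I(α) = {C < d ≤ min(c + C, 1/(αc))}` ("We rearrange this sum of integrals as follows …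
  `d` runs over integers prime to `c` in the interval `I = (C, min{c + C, 1/(|α|c)}]` (4.13)");
* `sum_fourierChar_inv_eq_ramanujanSum`: "`I = (C, c + C]` has length exactly `c`" — the `d` with
  `(c,d) = 1` in it give every reduced residue `a = d̄` once, so the leading term carries the
  complete Ramanujan sum `r_c(h)` (4.15).

## References

* [ConreyIwaniec2002] B. Conrey, H. Iwaniec, Acta Arith. 103 (2002) 259–312, arXiv:math/0111012:
  §4 (4.10)–(4.13), (4.15).
-/

noncomputable section

open scoped FourierTransform
open Finset MeasureTheory Complex

namespace Literature.NumberTheory.LFunctions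

namespace ConreyIwaniec2002

namespace CircleMethod

open Literature.NumberTheory.Sieve (ramanujanSum)

/-! ### The zero detector for exponentials and finite trigonometric sums -/

/-- `e(x) + e(−x) = 2cos(2πx)` in `ℂ`. [folklore] -/
private theorem fourierChar_add_fourierChar_neg (x : ℝ) :
    ((𝐞 x : ℂ) + (𝐞 (-x) : ℂ)) = ((2 * Real.cos (2 * Real.pi * x) : ℝ) : ℂ) := by
  rw [Real.fourierChar_apply, Real.fourierChar_apply]
  push_cast
  rw [Complex.two_cos]
  congr 1; congr 1; ring

/-- `α ↦ e(f(α))` is continuous for continuous `f`. [folklore] -/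
private theorem continuous_fourierChar_comp {f : ℝ → ℝ} (hf : Continuous f) :
    Continuous fun α : ℝ ↦ (𝐞 (f α) : ℂ) := by
  have : (fun α : ℝ ↦ (𝐞 (f α) : ℂ)) =
      fun α ↦ Complex.exp (((2 * Real.pi * f α : ℝ) : ℂ) * Complex.I) := by
    funext α; exact Real.fourierChar_apply (f α)
  rw [this]
  fun_prop

/-- **(4.10) for exponentials**: for `k ∈ ℤ` and an integer `C ≥ 1`,
`Σ_{c ≤ C < d ≤ c+C, (c,d)=1} ∫₀^{1/cd} (e(k(a/c − α)) + e(−k(a/c − α))) dα = [k = 0]`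
(`a = d̄ mod c`), i.e. (4.10) with `2cos = e + ē`. [cite: ConreyIwaniec2002, §4 (4.10)] -/
theorem dissection_fourierChar (hZ : ZeroDetectorIdentity) {C : ℕ} (hC : 1 ≤ C) (k : ℤ) :
    ∑ c ∈ Finset.Icc 1 C, ∑ d ∈ (Finset.Ioc C (c + C)).filter (fun d ↦ Nat.Coprime c d),
        ∫ α in (0 : ℝ)..(1 / ((c : ℝ) * d)),
          ((𝐞 (k * ((((d : ZMod c)⁻¹).val : ℝ) / c - α)) : ℂ) +
            (𝐞 (-(k * ((((d : ZMod c)⁻¹).val : ℝ) / c - α))) : ℂ)) =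
      if k = 0 then 1 else 0 := by
  have key : ∑ c ∈ Finset.Icc 1 C, ∑ d ∈ (Finset.Ioc C (c + C)).filter (fun d ↦ Nat.Coprime c d),
      ∫ α in (0 : ℝ)..(1 / ((c : ℝ) * d)),
        2 * Real.cos (2 * Real.pi * (k * ((((d : ZMod c)⁻¹).val : ℝ) / c - α))) =
      if k = 0 then (1 : ℝ) else 0 := by
    rw [← hZ C hC k, Finset.mul_sum]
    refine Finset.sum_congr rfl fun c _ ↦ ?_
    rw [Finset.mul_sum]
    refine Finset.sum_congr rfl fun d _ ↦ ?_
    rw [← intervalIntegral.integral_const_mul]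
    refine intervalIntegral.integral_congr fun α _ ↦ ?_
    ring_nf
  simp_rw [fourierChar_add_fourierChar_neg]
  simp_rw [intervalIntegral.integral_ofReal]
  simp_rw [← Complex.ofReal_sum]
  rw [key]
  split_ifs <;> simp

/-- **The dissection of a finite trigonometric sum** (linearity over (4.10)): if
`F(θ) = Σ_{i ∈ s} f_i e(k_iθ)` with integer frequencies `k_i`, then for an integer `C ≥ 1`
`Σ_{c ≤ C < d ≤ c+C, (c,d)=1} ∫₀^{1/cd} (F(a/c − α) + F(−(a/c − α))) dα = Σ_{i : k_i = 0} f_i`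
(`a = d̄ mod c`) — the constant term of `F`. With `F(θ) = e(−hθ)S₁(θ)S̄₂(θ)` this is the first
display after (4.10). [cite: ConreyIwaniec2002, §4 (4.10)–(4.11)] -/
theorem dissection_trigSum (hZ : ZeroDetectorIdentity) {C : ℕ} (hC : 1 ≤ C) {ι : Type*}
    (s : Finset ι) (coef : ι → ℂ) (freq : ι → ℤ) (F : ℝ → ℂ)
    (hF : ∀ θ : ℝ, F θ = ∑ i ∈ s, coef i * (𝐞 ((freq i : ℝ) * θ) : ℂ)) :
    ∑ c ∈ Finset.Icc 1 C, ∑ d ∈ (Finset.Ioc C (c + C)).filter (fun d ↦ Nat.Coprime c d),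
        ∫ α in (0 : ℝ)..(1 / ((c : ℝ) * d)),
          (F (((((d : ZMod c)⁻¹).val : ℝ) / c - α)) + F (-(((((d : ZMod c)⁻¹).val : ℝ) / c - α)))) =
      ∑ i ∈ s.filter (fun i ↦ freq i = 0), coef i := by
  classical
  -- pointwise: `F(x) + F(-x) = Σ_i f_i (e(k_i x) + e(-k_i x))`
  have hpt : ∀ x : ℝ, F x + F (-x) =
      ∑ i ∈ s, coef i * ((𝐞 ((freq i : ℝ) * x) : ℂ) + (𝐞 (-((freq i : ℝ) * x)) : ℂ)) := by
    intro x
    rw [hF, hF, ← Finset.sum_add_distrib]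
    refine Finset.sum_congr rfl fun i _ ↦ ?_
    rw [mul_add, mul_neg]
  simp_rw [hpt]
  -- integrate termwise
  have hint : ∀ (c d : ℕ), ∫ α in (0 : ℝ)..(1 / ((c : ℝ) * d)),
      ∑ i ∈ s, coef i * ((𝐞 ((freq i : ℝ) * ((((d : ZMod c)⁻¹).val : ℝ) / c - α)) : ℂ) +
        (𝐞 (-((freq i : ℝ) * ((((d : ZMod c)⁻¹).val : ℝ) / c - α))) : ℂ)) =
      ∑ i ∈ s, coef i * ∫ α in (0 : ℝ)..(1 / ((c : ℝ) * d)),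
        ((𝐞 ((freq i : ℝ) * ((((d : ZMod c)⁻¹).val : ℝ) / c - α)) : ℂ) +
          (𝐞 (-((freq i : ℝ) * ((((d : ZMod c)⁻¹).val : ℝ) / c - α))) : ℂ)) := by
    intro c d
    rw [intervalIntegral.integral_finsetSum]
    · refine Finset.sum_congr rfl fun i _ ↦ ?_
      rw [intervalIntegral.integral_const_mul]
    · intro i _
      refine (Continuous.intervalIntegrable ?_ _ _)
      refine continuous_const.mul ?_
      exact (continuous_fourierChar_comp (by fun_prop)).add
        (continuous_fourierChar_comp (by fun_prop))
  simp_rw [hint]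
  rw [Finset.sum_congr rfl (fun c _ ↦ Finset.sum_comm), Finset.sum_comm]
  simp_rw [← Finset.mul_sum]
  rw [Finset.sum_filter]
  refine Finset.sum_congr rfl fun i _ ↦ ?_
  rw [dissection_fourierChar hZ hC (freq i)]
  split_ifs <;> simp

/-- **Bookkeeping for the shifted sum**: over `m ∈ I`, `n ∈ J` the pairs with `m − n − h = 0`
are `(n + h, n)`, so `Σ_{(m,n) : m−n−h=0} a(m,n) = Σ_{n ∈ J, n+h ∈ I} a(n+h, n)`; this turns the
constant term of `e(−hθ)S₁(θ)S̄₂(θ)` into `B(h) = Σ_{m−n=h} λ(m)λ̄(n)g₁(m)g₂(n)` (4.1).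
[cite: ConreyIwaniec2002, §4 (4.1), (4.10)] -/
theorem sum_filter_shift_eq (I J : Finset ℕ) (a : ℕ → ℕ → ℂ) (h : ℕ) :
    ∑ p ∈ (I ×ˢ J).filter (fun p : ℕ × ℕ ↦ (p.1 : ℤ) - p.2 - h = 0), a p.1 p.2 =
      ∑ n ∈ J.filter (fun n ↦ n + h ∈ I), a (n + h) n := by
  classical
  refine Finset.sum_nbij' (fun p ↦ p.2) (fun n ↦ (n + h, n)) ?_ ?_ ?_ ?_ ?_
  · intro p hp
    simp only [Finset.mem_filter, Finset.mem_product] at hp ⊢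
    have : p.1 = p.2 + h := by omega
    exact ⟨hp.1.2, this ▸ hp.1.1⟩
  · intro n hn
    simp only [Finset.mem_filter, Finset.mem_product] at hn ⊢
    exact ⟨⟨hn.2, hn.1⟩, by push_cast; ring⟩
  · intro p hp
    simp only [Finset.mem_filter, Finset.mem_product] at hp
    have : p.1 = p.2 + h := by omega
    ext <;> simp [this]
  · intro n _
    rfl
  · intro p hp
    simp only [Finset.mem_filter, Finset.mem_product] at hp
    have : p.1 = p.2 + h := by omega
    simp [this]

/-! ### The rearrangement (4.11)–(4.13) -/

/-- **(4.11)–(4.13)**: for `c ≥ 1` and `d`'s in `(C, c + C]`,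
`Σ_d ∫₀^{1/(cd)} G_d(α) dα = ∫₀^{1/(c(C+1))} Σ_{d : α ≤ 1/(cd)} G_d(α) dα` — "`d` runs over
integers … in the interval `I = (C, min{c + C, 1/(|α|c)}]`", every range `[0, 1/(cd)]`,
`d ≥ C + 1`, lying inside `[0, 1/(c(C+1))]`. [cite: ConreyIwaniec2002, §4 (4.11)–(4.13)] -/
theorem sum_intervalIntegral_eq_integral_sum_filter {c C : ℕ} (hc : 1 ≤ c) (D : Finset ℕ)
    (hD : ∀ d ∈ D, C + 1 ≤ d) (G : ℕ → ℝ → ℂ)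
    (hG : ∀ d ∈ D, IntervalIntegrable (G d) volume 0 (1 / ((c : ℝ) * (C + 1)))) :
    ∑ d ∈ D, ∫ α in (0 : ℝ)..(1 / ((c : ℝ) * d)), G d α =
      ∫ α in (0 : ℝ)..(1 / ((c : ℝ) * (C + 1))),
        ∑ d ∈ D.filter (fun d : ℕ ↦ α ≤ 1 / ((c : ℝ) * (d : ℝ))), G d α := by
  classical
  have hc' : (0 : ℝ) < c := by exact_mod_cast hc
  -- each `∫₀^{1/cd}` as an integral over `[0, 1/(c(C+1))]` of the cut-off integrand
  have hcut : ∀ d ∈ D, ∫ α in (0 : ℝ)..(1 / ((c : ℝ) * d)), G d α =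
      ∫ α in (0 : ℝ)..(1 / ((c : ℝ) * (C + 1))),
        Set.indicator {α : ℝ | α ≤ 1 / ((c : ℝ) * d)} (G d) α := by
    intro d hd
    rw [intervalIntegral.integral_indicator]
    have hd' : (C + 1 : ℝ) ≤ d := by exact_mod_cast hD d hd
    constructor
    · positivity
    · exact one_div_le_one_div_of_le (by positivity) (by gcongr)
  rw [Finset.sum_congr rfl hcut, ← intervalIntegral.integral_finsetSum]
  · refine intervalIntegral.integral_congr fun α _ ↦ ?_
    rw [Finset.sum_filter]
    refine Finset.sum_congr rfl fun d _ ↦ ?_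
    by_cases hα : α ≤ 1 / ((c : ℝ) * (d : ℝ))
    · rw [Set.indicator_of_mem (by exact hα), if_pos hα]
    · rw [Set.indicator_of_notMem (by exact hα), if_neg hα]
  · intro d hd
    exact ⟨(hG d hd).1.indicator measurableSet_Iic, (hG d hd).2.indicator measurableSet_Iic⟩

/-! ### The complete residue system `C < d ≤ c + C` -/

/-- For `c ≥ 1`, the `d ∈ (C, c + C]` prime to `c` represent every reduced residue class modulo
`c` exactly once, so `d ↦ d̄ = d⁻¹ (mod c)` maps them bijectively onto the reduced residues
`0 ≤ a < c`; hence `Σ_{C < d ≤ c+C, (c,d)=1} e(a_d t/c) = r_c(t)` for every `t ∈ ℤ`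
(`a_d = d̄`): "`I = (C, c + C]` has length exactly `c`", and "in the leading term we get exact
Ramanujan sum (4.15)". [cite: ConreyIwaniec2002, §4 (4.13), (4.15)] -/
theorem sum_fourierChar_inv_eq_ramanujanSum {c : ℕ} (hc : 1 ≤ c) (C : ℕ) (t : ℤ) :
    ∑ d ∈ (Finset.Ioc C (c + C)).filter (fun d ↦ Nat.Coprime c d),
        (𝐞 (((((d : ZMod c)⁻¹).val : ℝ)) * t / c) : ℂ) = ramanujanSum c t := by
  classical
  haveI : NeZero c := ⟨by omega⟩
  set D := (Finset.Ioc C (c + C)).filter (fun d ↦ Nat.Coprime c d) with hDdef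
  set inv : ℕ → ℕ := fun d ↦ ((d : ZMod c)⁻¹).val with hinv
  -- `inv` maps `D` into the reduced residues and is injective there
  have hmaps : ∀ d ∈ D, inv d ∈ (Finset.range c).filter (fun a : ℕ ↦ a.Coprime c) := by
    intro d hd
    rw [hDdef, Finset.mem_filter] at hd
    rw [Finset.mem_filter, Finset.mem_range]
    refine ⟨ZMod.val_lt _, ?_⟩
    have hu : IsUnit ((d : ZMod c)) := (ZMod.isUnit_iff_coprime d c).mpr hd.2.symm
    have hu' : IsUnit ((d : ZMod c)⁻¹) := by
      obtain ⟨u, hu⟩ := hu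
      exact ⟨u⁻¹, by rw [← hu, ZMod.inv_coe_unit]⟩
    have := (ZMod.isUnit_iff_coprime ((d : ZMod c)⁻¹).val c).mp (by rwa [ZMod.natCast_zmod_val])
    exact this
  have hinj : Set.InjOn inv (D : Set ℕ) := by
    intro d₁ hd₁ d₂ hd₂ heq
    rw [Finset.mem_coe, hDdef, Finset.mem_filter, Finset.mem_Ioc] at hd₁ hd₂
    simp only [hinv] at heq
    have h1 : ((d₁ : ZMod c)⁻¹) = ((d₂ : ZMod c)⁻¹) := ZMod.val_injective c heq
    have hu₁ : IsUnit ((d₁ : ZMod c)) := (ZMod.isUnit_iff_coprime d₁ c).mpr hd₁.2.symm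
    have hu₂ : IsUnit ((d₂ : ZMod c)) := (ZMod.isUnit_iff_coprime d₂ c).mpr hd₂.2.symm
    have h2 : (d₁ : ZMod c) = (d₂ : ZMod c) := by
      calc (d₁ : ZMod c) = d₁ * ((d₂ : ZMod c)⁻¹ * d₂) := by rw [ZMod.inv_mul_of_unit _ hu₂, mul_one]
        _ = d₁ * (d₁ : ZMod c)⁻¹ * d₂ := by rw [← h1, mul_assoc]
        _ = d₂ := by rw [ZMod.mul_inv_of_unit _ hu₁, one_mul]
    -- two naturals in an interval of length `c`, congruent mod `c`, are equal
    have h3 : d₁ % c = d₂ % c := (ZMod.natCast_eq_natCast_iff' d₁ d₂ c).mp h2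
    rcases le_total d₁ d₂ with hle | hle
    · have hlt : d₂ - d₁ < c := by omega
      have hmod : (d₂ - d₁) % c = 0 := Nat.sub_mod_eq_zero_of_mod_eq h3.symm
      rw [Nat.mod_eq_of_lt hlt] at hmod
      omega
    · have hlt : d₁ - d₂ < c := by omega
      have hmod : (d₁ - d₂) % c = 0 := Nat.sub_mod_eq_zero_of_mod_eq h3
      rw [Nat.mod_eq_of_lt hlt] at hmod
      omega
  -- the image is the whole reduced residue system (equal cardinalities)
  have hcard : D.card = ((Finset.range c).filter (fun a : ℕ ↦ a.Coprime c)).card := by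
    rw [hDdef, show Finset.Ioc C (c + C) = Finset.Ico (C + 1) (C + 1 + c) by
      ext d; simp only [Finset.mem_Ioc, Finset.mem_Ico]; omega]
    rw [Nat.filter_coprime_Ico_eq_totient, Nat.totient_eq_card_coprime,
      Finset.filter_congr (fun a _ ↦ Nat.coprime_comm)]
  have himage : D.image inv = (Finset.range c).filter (fun a : ℕ ↦ a.Coprime c) := by
    apply Finset.eq_of_subset_of_card_le
    · intro a ha
      rw [Finset.mem_image] at ha
      obtain ⟨d, hd, rfl⟩ := ha
      exact hmaps d hd
    · rw [Finset.card_image_of_injOn hinj, hcard]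
  rw [Literature.NumberTheory.Sieve.ramanujanSum_def, ← himage, Finset.sum_image hinj]

end CircleMethod

end ConreyIwaniec2002

end Literature.NumberTheory.LFunctions

end
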